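import Literature.Probability.Percolation.SlabGluingFact2
import HarnessLib

/-!
# DST 2016, §2.3, Fact 2 verbatim: reduction to recoverable local surgeries

Topic: `Literature/Probability/Percolation`. Towards the discharge of the named fact
`DuminilCopinSidoraviciusTassion2016_fact2` of `SlabGluing.lean` (Duminil-Copin–Sidoravicius–Tassion
2016, §2.3, Fact 2; since 2026-08-15 vendored as printed — "for `t` large enough,
`P[𝒳 ∩ {|U| ≥ t}] ≤ ε P[C]`", uniformly over the geometric range `GlueGeom.InRange`, which allows
`u_{3n} = n` — and implied by the rate form its proof displays, p. 7 of arXiv:1401.7130: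
`P[𝒳 ∩ {|U| ≥ t}] ≤ (K/t) · P[S_{3n} ⟷^{B_{3n} ∪ B'_n} S'_n]` for `t ≥ T₀`,
`DuminilCopinSidoraviciusTassion2016_fact2_bound_of_rate`; this file works with the rate form for
ALL `t ≥ 1`).

The tree proves this bound for `t ≥ 194` in the range `u_{3n} + 1 ≤ n` (`fact2_large`,
`SlabGluingFact2.lean`), which is all that Theorem 1 needs. The verbatim statement additionally
requires (i) the bound for `1 ≤ t ≤ 193`, i.e. `P[𝒳 ∩ {U ≠ ∅}] ≤ K · P[C]`, which asks for ONE
recoverable local surgery for EVERY `ω ∈ 𝒳` with `U(ω) ≠ ∅` — also at the boundedly many points of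
`U(ω)` near the end of `γ_min(ω)` or near the ends of `Z_n` that `fact2_large` skips — and (ii) the
range `u_{3n} = n`, where the cleared ball may meet `S̄_{3n}` (a case the printed proof does not
discuss). This file does the measure-theoretic half of the remaining work once and for all: it
isolates the purely combinatorial content as the predicate `GlueGeom.SurgOut` ("`ω'` is the output of
a recoverable local surgery of `ω` located at `z`") and PROVES

* `GlueGeom.real_le_of_surgOut` — **Lemma 7 for located surgeries**: if every lattice
  configuration of an event `E` (determined by the window) carries a `6`-separated family of at
  least `t` points, each with a surgery output located there, then `P[E] ≤ λ^s / t · P[C]`,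
  `λ = 2/min{p,1-p}`, `s = (5k+4)(2r+7)²` (the recovery window is read off the attachment
  statistic `Att` exactly as in `fact2_large`: `Att(ω') ≠ ∅`, `Att(ω') ⊆ \overline{z + B_3}`, and the
  preimages agree with `ω'` off the pairs touching `\overline{z + B_r} ⊆ \overline{planar(q) + B_{r+3}}`,
  `q ∈ Att(ω')`);
* `GlueGeom.real_evX_nonempty_le` (one surgery per configuration ⇒ `P[𝒳 ∩ {U ≠ ∅}] ≤ λ^s P[C]`) and
  `GlueGeom.real_evX_ncard_le` (surgeries at all but `N₀` points of `U` ⇒ the bound `338 λ^s / t`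
  for `t ≥ 2N₀`, via the greedy separated subfamily `exists_separated_subset`);
* `DuminilCopinSidoraviciusTassion2016_fact2_of_surgOut` — PROVED: **the named fact
  `…_fact2` follows from two combinatorial statements**, (H1) for `ω ∈ 𝒳` surgeries exist at all
  but `N₀` points of `U(ω)`, (H2) for `ω ∈ 𝒳` with `U(ω) ≠ ∅` one surgery exists — both over the
  whole range `GlueGeom.InRange`; with `K = (338 + 2N₀ + 1) λ^s`;
* `GlueGeom.Surgery.surgOut`, `GlueGeom.exists_surgOut_of_good`, `GlueGeom.exists_good_family` —
  PROVED: the surgery of `SlabGluingFact2Core.lean`/`SlabGluingRouting.lean` IS such an output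
  (`newConfig_mem_evC`, `mem_newConfig_iff_of_not_touch`, `c_mem_att`, `att_subset`), so (H1) holds
  with `r = 3`, `N₀ = 97` in the range `u_{3n} + 1 ≤ n` (`fact2_large` is the special case).

What remains for `…_fact2` after this file (recorded in the unit's notes): (H1) for `u_{3n} = n`
(surgeries near `S̄_{3n}` respecting the key condition of `GlueGeom.Surgery`), and (H2) over the
whole range (surgeries at the points near the end of `γ_min` / the ends of `Z_n`).

## Sources

* H. Duminil-Copin, V. Sidoravicius, V. Tassion, *Absence of infinite cluster for critical
  Bernoulli percolation on slabs*, Comm. Pure Appl. Math. 69 (2016), 1397–1411, arXiv:1401.7130: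
  §2.3, Lemma 7 and the proof of Fact 2 (pp. 6–7 of the arXiv text: the map
  `Ψ : ω ↦ {ω^{(z)}, z ∈ U(ω)}`, "the configurations `ω^{(z)}` are all distinct", "`z` is
  determined uniquely", "`ω` and `ω^{(z)}` differ only in `\overline{B_{R+1}}(z)`", the display
  `P[𝒳 ∩ {|U| > t}] ≤ ((2/min{p,1-p})^C / t) · P[S_{3n} ⟷ S'_n]`).
* C. M. Newman, V. Tassion, W. Wu, *Critical percolation and the minimal spanning tree in slabs*,
  CPAM 70 (2017), §3.2, proof of Thm. 3.9 [NewmanTassionWu2017].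

## Design choices

* `SurgOut` is the exact interface consumed by the Lemma 7 bookkeeping: membership in `C`, support
  in the window `ω ∪ (E(S_k) ∩ \overline{B_{3n} ∪ B'_n}^{(2)})`, agreement off `touch (z + B_r)`, and
  the two properties of DST's recovery statistic `GlueGeom.att`. Any other surgery mechanism (at
  the excluded points) only has to produce this predicate; the radius `r` is a parameter
  (`SurgOut.mono`).
* No new named fact is introduced: (H1), (H2) are hypotheses of the reduction theorem, spelled out.
-/

noncomputable section

namespace Literature.Probability.Percolation

open MeasureTheory LatticeModels SimpleGraph Finset

/-! ## Small helpers -/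

section Helpers

variable {k : ℕ}

/-- `touch` is monotone in the set of columns. [folklore] -/
theorem touch_mono {D D' : Set (ℤ × ℤ)} (h : D ⊆ D') : touch k D ⊆ touch k D' := by
  rintro e ⟨x, hx, hxD⟩
  exact ⟨x, hx, h hxD⟩

/-- A box of radius `r` about `z` lies in the box of radius `r + 3` about any point of `z + B_3`.
[folklore] -/
theorem sqBox_subset_sqBox_add_three {z q : ℤ × ℤ} (hq : q ∈ sqBox z 3) (r : ℕ) :
    sqBox z r ⊆ sqBox q (r + 3) := by
  intro w hw
  simp only [sqBox, Set.mem_setOf_eq, abs_le, Nat.cast_ofNat, Nat.cast_add] at hq hw ⊢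
  omega

/-- The events `𝒳` only depend on the window `\overline{B_{3n} ∪ B'_n}`. [folklore] -/
theorem GlueGeom.mem_evX_congr (G : GlueGeom) (k : ℕ) {ω ω' : BondConfig (slab 3 k)}
    (h : ∀ e ∈ (slabLift k (G.big ∪ G.small)).sym2, e ∈ ω ↔ e ∈ ω') :
    ω ∈ G.evX k ↔ ω' ∈ G.evX k := by
  simp only [GlueGeom.evX, GlueGeom.evA, GlueGeom.evBm, GlueGeom.evBp, GlueGeom.evC,
    Set.mem_inter_iff, Set.mem_compl_iff]
  rw [mem_slabConn_congr k G h Set.subset_union_left, mem_slabConn_congr k G h Set.subset_union_right,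
    mem_slabConn_congr k G h Set.subset_union_right, mem_slabConn_congr k G h subset_rfl]

end Helpers

/-! ## The output of a recoverable local surgery -/

section SurgOutDef

/-- **The output of one recoverable local surgery of `ω` located at `z`** (the properties of
DST's `ω^{(z)}` that the proof of Fact 2 uses, pp. 6–7: "By construction, `ω^{(z)}` is in
`{S_{3n} ⟷ S'_n}`", "`ω` and `ω^{(z)}` differ only in `\overline{B_{R+1}}(z)`", and the recovery of `z`
from `ω^{(z)}` through the vertices of `γ_min(ω^{(z)})` joined to `S̄'_n` off `γ_min(ω^{(z)})`, here
`GlueGeom.att`): `ω' ∈ C`; `ω'` consists of edges of `ω` and lattice edges of the window; `ω'`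
agrees with `ω` off the pairs touching `\overline{z + B_r}`; `Att(ω')` is non-empty and lies over
`z + B_3`. [cite: DuminilCopinSidoraviciusTassion2016, §2.3, proof of Fact 2 (pp. 6–7)] -/
structure GlueGeom.SurgOut (G : GlueGeom) (k r : ℕ) (ω : BondConfig (slab 3 k)) (z : ℤ × ℤ)
    (ω' : BondConfig (slab 3 k)) : Prop where
  /-- the new configuration realises `C` -/
  mem_evC : ω' ∈ G.evC k
  /-- it consists of old edges and lattice edges of the window -/
  subset_window : ω' ⊆ ω ∪ ((slabGraph 3 k).edgeSet ∩ (slabLift k (G.big ∪ G.small)).sym2)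
  /-- it agrees with `ω` off the pairs touching `\overline{z + B_r}` -/
  agree_off : ∀ e, e ∉ touch k (sqBox z r) → (e ∈ ω' ↔ e ∈ ω)
  /-- the attachment statistic is non-empty -/
  att_nonempty : (G.att k ω').Nonempty
  /-- and lies over `z + B_3` -/
  att_near : ∀ q ∈ G.att k ω', planar k q ∈ sqBox z 3

variable {k : ℕ} {G : GlueGeom}

/-- Enlarging the radius. [folklore] -/
theorem GlueGeom.SurgOut.mono {r r' : ℕ} (hr : r ≤ r') {ω ω' : BondConfig (slab 3 k)} {z : ℤ × ℤ}
    (h : G.SurgOut k r ω z ω') : G.SurgOut k r' ω z ω' where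
  mem_evC := h.mem_evC
  subset_window := h.subset_window
  agree_off := fun e he => h.agree_off e fun he' => he (touch_mono (sqBox_mono z hr) he')
  att_nonempty := h.att_nonempty
  att_near := h.att_near

/-- PROVED — **the surgery of `SlabGluingFact2Core.lean` is a recoverable located surgery**: for
`ω ∈ 𝒳` and surgery data with cleared box `D ⊆ z + B_3`, `ω^{(z)}` is an output located at `z` with
radius `3` (`newConfig_mem_evC`, `mem_window_of_mem_newConfig`, `mem_newConfig_iff_of_not_touch`,
`att_nonempty`, `att_subset`). [cite: DuminilCopinSidoraviciusTassion2016, §2.3, proof of Fact 2 (pp. 6–7)] -/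
theorem GlueGeom.Surgery.surgOut {ω : BondConfig (slab 3 k)} (sg : G.Surgery k ω) (hX : ω ∈ G.evX k)
    {z : ℤ × ℤ} (hD : sg.D ⊆ sqBox z 3) : G.SurgOut k 3 ω z sg.newConfig where
  mem_evC := sg.newConfig_mem_evC hX
  subset_window := fun e he => by
    rcases sg.mem_window_of_mem_newConfig hX.1.1.1 he with h | ⟨h1, h2⟩
    · exact Or.inl h
    · exact Or.inr ⟨h1, h2⟩
  agree_off := fun e he => sg.mem_newConfig_iff_of_not_touch fun h => he (touch_mono hD h)
  att_nonempty := sg.att_nonempty hX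
  att_near := fun q hq => by
    have := sg.att_subset hX hq
    rw [mem_slabLift_iff] at this
    exact hD this

/-- A located surgery exists at every good point of `U(ω)` (range `u_{3n} + 1 ≤ n`), by
`GlueGeom.exists_surgery`. [cite: DuminilCopinSidoraviciusTassion2016, §2.3, proof of Fact 2 (construction of ω^{(z)})] -/
theorem GlueGeom.exists_surgOut_of_good (hG : G.InRange) (hu : G.u₃ + 1 ≤ G.n) (hk : 0 < k)
    {ω : BondConfig (slab 3 k)} (hω : ω ⊆ (slabGraph 3 k).edgeSet) (hX : ω ∈ G.evX k)
    {z : ℤ × ℤ} (hz : z ∈ G.good k ω) : ∃ ω', G.SurgOut k 3 ω z ω' :=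
  ⟨_, (GlueGeom.surgAt hG hu hk hω hX hz).surgOut hX (GlueGeom.surgAt_D hG hu hk hω hX hz)⟩

/-- PROVED — hypothesis (H1) of the reduction in the range `u_{3n} + 1 ≤ n`: for `ω ∈ 𝒳` a lattice
configuration, located surgeries (radius `3`) exist at all but at most `97` points of `U(ω)` (the
good points, `GlueGeom.ncard_U_le_good`). [cite: DuminilCopinSidoraviciusTassion2016, §2.3, proof of Fact 2] -/
theorem GlueGeom.exists_good_family (hG : G.InRange) (hu : G.u₃ + 1 ≤ G.n) (hk : 0 < k)
    {ω : BondConfig (slab 3 k)} (hω : ω ⊆ (slabGraph 3 k).edgeSet) (hX : ω ∈ G.evX k) :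
    ∃ Good : Finset (ℤ × ℤ), (↑Good : Set (ℤ × ℤ)) ⊆ G.U k ω ∧ (G.U k ω).ncard ≤ Good.card + 97 ∧
      ∀ z ∈ Good, ∃ ω', G.SurgOut k 3 ω z ω' := by
  refine ⟨(G.good_finite k ω).toFinset, fun z hz => ?_, G.ncard_U_le_good ω, fun z hz => ?_⟩
  · exact ((Set.Finite.mem_toFinset _).1 hz).1
  · exact G.exists_surgOut_of_good hG hu hk hω hX ((Set.Finite.mem_toFinset _).1 hz)

end SurgOutDef

/-! ## Lemma 7 for located surgeries -/

section Lemma7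

variable (G : GlueGeom) (k : ℕ)

/-- PROVED — **Lemma 7 applied to a separated family of located surgeries** (the bookkeeping of
the proof of Fact 2, DST 2016, p. 7, in a reusable form): let `E` be an event determined by the
window `\overline{B_{3n} ∪ B'_n}` such that every lattice configuration `ω ∈ E` carries a set `Zs(ω)` of
at least `t` points, pairwise at sup-distance `> 6`, with a located surgery output of radius `r` at
each. Then `P[E] ≤ (2/min{p,1-p})^{(5k+4)(2r+7)²} / t · P[C]`. The images at two points of `Zs(ω)`
are distinct because their attachment statistics lie over disjoint boxes; every preimage of `ω'`
agrees with `ω'` off the lattice edges touching `\overline{planar(q) + B_{r+3}}`, `q ∈ Att(ω')`.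
[cite: DuminilCopinSidoraviciusTassion2016, §2.3, Lemma 7 and proof of Fact 2 (p. 7)] -/
theorem GlueGeom.real_le_of_surgOut (p : unitInterval) (hp0 : 0 < (p : ℝ)) (hp1 : (p : ℝ) < 1)
    (r : ℕ) {E : Set (BondConfig (slab 3 k))}
    (hE : ∀ ω ω' : BondConfig (slab 3 k),
      (∀ e ∈ (slabLift k (G.big ∪ G.small)).sym2, e ∈ ω ↔ e ∈ ω') → (ω ∈ E ↔ ω' ∈ E))
    {t : ℝ} (ht : 0 < t)
    (hfam : ∀ ω : BondConfig (slab 3 k), ω ⊆ (slabGraph 3 k).edgeSet → ω ∈ E →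
      ∃ Zs : Finset (ℤ × ℤ), t ≤ Zs.card ∧ (∀ z ∈ Zs, ∀ z' ∈ Zs, z ≠ z' → z' ∉ sqBox z 6) ∧
        ∀ z ∈ Zs, ∃ ω', G.SurgOut k r ω z ω') :
    (bondPercolation (slabGraph 3 k) p).real E ≤
      (2 / min (p : ℝ) (1 - p)) ^ ((5 * k + 4) * (2 * (r + 3) + 1) ^ 2) / t *
        (bondPercolation (slabGraph 3 k) p).real (G.evC k) := by
  classical
  -- the window
  have hRfin : (slabLift k (G.big ∪ G.small)).Finite :=
    slabLift_finite k ((sqBox_finite _ _).union (sqBox_finite _ _))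
  set K' : Finset (Sym2 (slab 3 k)) := (finite_sym2 hRfin).toFinset with hK'def
  have hK'coe : (↑K' : Set (Sym2 (slab 3 k))) = (slabLift k (G.big ∪ G.small)).sym2 :=
    Set.Finite.coe_toFinset _
  set Kfin : Finset (Sym2 (slab 3 k)) := K'.filter (· ∈ (slabGraph 3 k).edgeSet) with hKfin
  have hK : ∀ e, e ∈ Kfin ↔ e ∈ K' ∧ e ∈ (slabGraph 3 k).edgeSet := fun e => Finset.mem_filter
  have hKE : ∀ e ∈ Kfin, e ∈ (slabGraph 3 k).edgeSet := fun e he => ((hK e).1 he).2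
  have hagree : ∀ ω ω' : BondConfig (slab 3 k), ω ∩ ↑K' = ω' ∩ ↑K' →
      ∀ e ∈ (slabLift k (G.big ∪ G.small)).sym2, e ∈ ω ↔ e ∈ ω' := by
    intro ω ω' heq e he
    rw [← hK'coe] at he
    have := Set.ext_iff.1 heq e
    simp only [Set.mem_inter_iff, he, and_true] at this
    exact this
  have hA : DeterminedBy E ↑K' := by
    rw [determinedBy_iff]
    intro ω ω' heq
    exact hE ω ω' (hagree ω ω' heq)
  have hB : DeterminedBy (G.evC k) ↑K' := by
    rw [determinedBy_iff]
    intro ω ω' heq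
    exact mem_slabConn_congr k G (hagree ω ω' heq) subset_rfl _ _
  have hlat : ∀ S : Finset (Sym2 (slab 3 k)), S ⊆ Kfin →
      (↑S : Set (Sym2 (slab 3 k))) ⊆ (slabGraph 3 k).edgeSet := fun S hS e he => hKE e (hS he)
  -- surgery outputs lie in the window
  have hnewK : ∀ S : Finset (Sym2 (slab 3 k)), S ⊆ Kfin → ∀ (z : ℤ × ℤ) (ω' : BondConfig (slab 3 k)),
      G.SurgOut k r (↑S) z ω' → ω' ⊆ ↑Kfin := by
    intro S hS z ω' hso e he
    rcases hso.subset_window he with h | ⟨h1, h2⟩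
    · exact hS h
    · rw [Finset.mem_coe, hK]
      exact ⟨by rw [← Finset.mem_coe, hK'coe]; exact h2, h1⟩
  have hcoe : ∀ S : Finset (Sym2 (slab 3 k)), S ⊆ Kfin → ∀ (z : ℤ × ℤ) (ω' : BondConfig (slab 3 k)),
      G.SurgOut k r (↑S) z ω' → (↑(Kfin.filter (· ∈ ω')) : Set (Sym2 (slab 3 k))) = ω' := by
    intro S hS z ω' hso
    ext e
    simp only [Finset.coe_filter, Set.mem_setOf_eq, and_iff_right_iff_imp]
    exact fun he => hnewK S hS z ω' hso he
  -- the families, as functions of the configuration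
  have hfam' : ∀ S : Finset (Sym2 (slab 3 k)),
      (↑S : Set (Sym2 (slab 3 k))) ⊆ (slabGraph 3 k).edgeSet ∧ (↑S : BondConfig (slab 3 k)) ∈ E →
      ∃ Zs : Finset (ℤ × ℤ), t ≤ Zs.card ∧ (∀ z ∈ Zs, ∀ z' ∈ Zs, z ≠ z' → z' ∉ sqBox z 6) ∧
        ∀ z ∈ Zs, ∃ ω', G.SurgOut k r (↑S) z ω' := fun S h => hfam _ h.1 h.2
  let Zs : Finset (Sym2 (slab 3 k)) → Finset (ℤ × ℤ) := fun S =>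
    if h : (↑S : Set (Sym2 (slab 3 k))) ⊆ (slabGraph 3 k).edgeSet ∧ (↑S : BondConfig (slab 3 k)) ∈ E then
      Classical.choose (hfam' S h) else ∅
  have hZs : ∀ (S : Finset (Sym2 (slab 3 k)))
      (h : (↑S : Set (Sym2 (slab 3 k))) ⊆ (slabGraph 3 k).edgeSet ∧ (↑S : BondConfig (slab 3 k)) ∈ E),
      t ≤ (Zs S).card ∧ (∀ z ∈ Zs S, ∀ z' ∈ Zs S, z ≠ z' → z' ∉ sqBox z 6) ∧
        ∀ z ∈ Zs S, ∃ ω', G.SurgOut k r (↑S) z ω' := by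
    intro S h
    simp only [Zs, dif_pos h]
    exact Classical.choose_spec (hfam' S h)
  let out : Finset (Sym2 (slab 3 k)) → (ℤ × ℤ) → BondConfig (slab 3 k) := fun S z =>
    if h : ∃ ω', G.SurgOut k r (↑S) z ω' then Classical.choose h else ∅
  have hout : ∀ (S : Finset (Sym2 (slab 3 k))) (z : ℤ × ℤ), (∃ ω', G.SurgOut k r (↑S) z ω') →
      G.SurgOut k r (↑S) z (out S z) := by
    intro S z h
    simp only [out, dif_pos h]
    exact Classical.choose_spec h
  -- the multi-valued map
  let Φ : Finset (Sym2 (slab 3 k)) → Finset (Finset (Sym2 (slab 3 k))) := fun S =>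
    (Zs S).image fun z => Kfin.filter (· ∈ out S z)
  set s : ℕ := (5 * k + 4) * (2 * (r + 3) + 1) ^ 2 with hs
  refine lemma7_bond (slabGraph 3 k) p hp0 hp1 K' Kfin hK hA hB s ht Φ ?_ ?_ ?_
  · -- images lie in `C`
    intro S hS hSA S' hS'
    have h : (↑S : Set (Sym2 (slab 3 k))) ⊆ (slabGraph 3 k).edgeSet ∧ (↑S : BondConfig (slab 3 k)) ∈ E :=
      ⟨hlat S hS, hSA⟩
    simp only [Φ, Finset.mem_image] at hS'
    obtain ⟨z, hz, rfl⟩ := hS'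
    have hso := hout S z ((hZs S h).2.2 z hz)
    refine ⟨Finset.filter_subset _ _, ?_⟩
    rw [hcoe S hS z _ hso]
    exact hso.mem_evC
  · -- at least `t` distinct images
    intro S hS hSA
    have h : (↑S : Set (Sym2 (slab 3 k))) ⊆ (slabGraph 3 k).edgeSet ∧ (↑S : BondConfig (slab 3 k)) ∈ E :=
      ⟨hlat S hS, hSA⟩
    obtain ⟨hcard, hsep, hex⟩ := hZs S h
    have hinj : Set.InjOn (fun z => Kfin.filter (· ∈ out S z)) ↑(Zs S) := by
      intro z hz z' hz' heq
      by_contra hne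
      have hso := hout S z (hex z hz)
      have hso' := hout S z' (hex z' hz')
      have heq' : out S z = out S z' := by
        have := congrArg (fun F : Finset (Sym2 (slab 3 k)) => (↑F : Set (Sym2 (slab 3 k)))) heq
        simp only at this
        rwa [hcoe S hS z _ hso, hcoe S hS z' _ hso'] at this
      obtain ⟨q, hq⟩ := hso.att_nonempty
      have h1 := hso.att_near q hq
      rw [heq'] at hq
      have h2 := hso'.att_near q hq
      exact hsep z hz z' hz' hne (mem_sqBox_six_of_three h1 h2)
    simp only [Φ]
    rw [Finset.card_image_of_injOn hinj]
    exact hcard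
  · -- the recovery window
    intro S' hS' _
    by_cases hq : (G.att k (↑S' : BondConfig (slab 3 k))).Nonempty
    · obtain ⟨q₀, hq₀⟩ := hq
      refine ⟨Kfin.filter fun e => ∃ u ∈ e, planar k u ∈ (sqBox_finite (planar k q₀) (r + 3)).toFinset,
        ?_, ?_⟩
      · refine (card_filter_colEdges_le k Kfin hKE _).trans ?_
        have := card_toFinset_sqBox_le (planar k q₀) (r + 3)
        rw [hs]; exact Nat.mul_le_mul_left _ this
      · intro S hS hSA hmem e heT
        have h : (↑S : Set (Sym2 (slab 3 k))) ⊆ (slabGraph 3 k).edgeSet ∧ (↑S : BondConfig (slab 3 k)) ∈ E :=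
          ⟨hlat S hS, hSA⟩
        simp only [Φ, Finset.mem_image] at hmem
        obtain ⟨z, hz, rfl⟩ := hmem
        have hso := hout S z ((hZs S h).2.2 z hz)
        have hcoe' := hcoe S hS z _ hso
        rw [hcoe'] at hq₀
        have hq₀z : planar k q₀ ∈ sqBox z 3 := hso.att_near q₀ hq₀
        have hsub : sqBox z r ⊆ sqBox (planar k q₀) (r + 3) := sqBox_subset_sqBox_add_three hq₀z r
        by_cases heK : e ∈ Kfin
        · have hnt : e ∉ touch k (sqBox z r) := by
            rintro ⟨x, hx, hxD⟩
            exact heT (Finset.mem_filter.2 ⟨heK, x, hx, (Set.Finite.mem_toFinset _).2 (hsub hxD)⟩)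
          have := hso.agree_off e hnt
          rw [Finset.mem_filter]
          constructor
          · intro heS; exact ⟨heK, this.2 heS⟩
          · intro heS'; exact this.1 heS'.2
        · constructor
          · intro heS; exact absurd (hS heS) heK
          · intro heS'; exact absurd (Finset.mem_filter.1 heS').1 heK
    · refine ⟨∅, by simp, ?_⟩
      intro S hS hSA hmem
      exfalso
      apply hq
      have h : (↑S : Set (Sym2 (slab 3 k))) ⊆ (slabGraph 3 k).edgeSet ∧ (↑S : BondConfig (slab 3 k)) ∈ E :=
        ⟨hlat S hS, hSA⟩
      simp only [Φ, Finset.mem_image] at hmem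
      obtain ⟨z, hz, rfl⟩ := hmem
      have hso := hout S z ((hZs S h).2.2 z hz)
      rw [hcoe S hS z _ hso]
      exact hso.att_nonempty

/-- PROVED — **one located surgery per configuration bounds `P[𝒳 ∩ {U ≠ ∅}]`**:
`P[𝒳 ∩ {U ≠ ∅}] ≤ (2/min{p,1-p})^{(5k+4)(2r+7)²} · P[C]` (Lemma 7 with `t = 1`; this is the bound
behind Fact 2 for bounded `t`). [cite: DuminilCopinSidoraviciusTassion2016, §2.3, Lemma 7 and proof of Fact 2] -/
theorem GlueGeom.real_evX_nonempty_le (p : unitInterval) (hp0 : 0 < (p : ℝ)) (hp1 : (p : ℝ) < 1) (r : ℕ)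
    (h2 : ∀ ω : BondConfig (slab 3 k), ω ⊆ (slabGraph 3 k).edgeSet → ω ∈ G.evX k →
      (G.U k ω).Nonempty → ∃ (z : ℤ × ℤ) (ω' : BondConfig (slab 3 k)), G.SurgOut k r ω z ω') :
    (bondPercolation (slabGraph 3 k) p).real (G.evX k ∩ {ω | (G.U k ω).Nonempty}) ≤
      (2 / min (p : ℝ) (1 - p)) ^ ((5 * k + 4) * (2 * (r + 3) + 1) ^ 2) *
        (bondPercolation (slabGraph 3 k) p).real (G.evC k) := by
  have := G.real_le_of_surgOut k p hp0 hp1 r (E := G.evX k ∩ {ω | (G.U k ω).Nonempty}) ?_ one_pos ?_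
  · simpa using this
  · intro ω ω' h
    simp only [Set.mem_inter_iff, Set.mem_setOf_eq]
    rw [G.mem_evX_congr k h, G.U_congr k h]
  · rintro ω hω ⟨hX, hU⟩
    obtain ⟨z, ω', hso⟩ := h2 ω hω hX hU
    refine ⟨{z}, by simp, ?_, ?_⟩
    · intro a ha b hb hab
      rw [Finset.mem_singleton] at ha hb
      exact absurd (ha.trans hb.symm) hab
    · intro a ha
      rw [Finset.mem_singleton] at ha
      subst ha
      exact ⟨ω', hso⟩

/-- PROVED — **located surgeries at all but `N₀` points of `U` bound `P[𝒳 ∩ {|U| ≥ t}]` for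
`t ≥ 2N₀`**: `P[𝒳 ∩ {|U| ≥ t}] ≤ 338 (2/min{p,1-p})^{(5k+4)(2r+7)²} / t · P[C]` (a `7`-separated
subfamily of the given points has at least `(t - N₀)/169 ≥ t/338` members,
`exists_separated_subset`; Lemma 7). [cite: DuminilCopinSidoraviciusTassion2016, §2.3, proof of Fact 2 (p. 7)] -/
theorem GlueGeom.real_evX_ncard_le (p : unitInterval) (hp0 : 0 < (p : ℝ)) (hp1 : (p : ℝ) < 1) (r N₀ : ℕ)
    (h1 : ∀ ω : BondConfig (slab 3 k), ω ⊆ (slabGraph 3 k).edgeSet → ω ∈ G.evX k →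
      ∃ Good : Finset (ℤ × ℤ), (↑Good : Set (ℤ × ℤ)) ⊆ G.U k ω ∧ (G.U k ω).ncard ≤ Good.card + N₀ ∧
        ∀ z ∈ Good, ∃ ω' : BondConfig (slab 3 k), G.SurgOut k r ω z ω')
    {t : ℕ} (ht : 1 ≤ t) (htN : 2 * N₀ ≤ t) :
    (bondPercolation (slabGraph 3 k) p).real (G.evX k ∩ {ω | t ≤ (G.U k ω).ncard}) ≤
      338 * (2 / min (p : ℝ) (1 - p)) ^ ((5 * k + 4) * (2 * (r + 3) + 1) ^ 2) / t *
        (bondPercolation (slabGraph 3 k) p).real (G.evC k) := by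
  have ht0 : (0 : ℝ) < (t : ℝ) / 338 := by positivity
  have := G.real_le_of_surgOut k p hp0 hp1 r (E := G.evX k ∩ {ω | t ≤ (G.U k ω).ncard}) ?_ ht0 ?_
  · refine this.trans_eq ?_
    congr 1
    field_simp
  · intro ω ω' h
    simp only [Set.mem_inter_iff, Set.mem_setOf_eq]
    rw [G.mem_evX_congr k h, G.U_congr k h]
  · rintro ω hω ⟨hX, htU⟩
    obtain ⟨Good, -, hcardU, hsurg⟩ := h1 ω hω hX
    obtain ⟨Sel, hSel, hsep, hcard⟩ := exists_separated_subset 6 Good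
    refine ⟨Sel, ?_, hsep, fun z hz => hsurg z (hSel hz)⟩
    have hc' : ((Good.card : ℕ) : ℝ) ≤ 169 * Sel.card := by
      have : Good.card ≤ 169 * Sel.card := by simpa using hcard
      exact_mod_cast this
    have hU' : ((G.U k ω).ncard : ℝ) ≤ Good.card + N₀ := by exact_mod_cast hcardU
    have htU' : (t : ℝ) ≤ (G.U k ω).ncard := by exact_mod_cast htU
    have htN' : (2 * N₀ : ℝ) ≤ t := by exact_mod_cast htN
    rw [div_le_iff₀ (by norm_num : (0 : ℝ) < 338)]
    linarith

end Lemma7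

/-! ## Fact 2 verbatim from the two combinatorial hypotheses -/

section Reduction

open GlueGeom

/-- PROVED — **`DuminilCopinSidoraviciusTassion2016_fact2` reduced to located surgeries.**
Hypotheses, both purely combinatorial and over the whole range `GlueGeom.InRange`: (H1) for every
lattice configuration `ω ∈ 𝒳`, located surgery outputs (radius `r`) exist at all but at most `N₀`
points of `U(ω)`; (H2) for every lattice configuration `ω ∈ 𝒳` with `U(ω) ≠ ∅`, one located surgery
output exists. Conclusion: the rate form `P[𝒳 ∩ {|U| ≥ t}] ≤ (K/t) P[C]` for all `t ≥ 1` with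
`K = (338 + 2N₀ + 1) λ^{(5k+4)(2r+7)²}` — for `t ≥ 2N₀` by `real_evX_ncard_le`, for `t < 2N₀ + 1`
by `real_evX_nonempty_le` and `{|U| ≥ t} ⊆ {U ≠ ∅}` (`t ≥ 1`) — hence the named fact (Fact 2 as
printed, "for `t` large enough … `≤ ε P[C]`", by `…_fact2_bound_of_rate`). ((H1) holds with
`r = 3`, `N₀ = 97` for `u_{3n} + 1 ≤ n`: `exists_good_family`. For the printed statement (H2) is
not needed: (H1) alone gives it through `real_evX_ncard_le` and `…_fact2_bound_of_rate` with
`T₀ = 2N₀`.) [cite: DuminilCopinSidoraviciusTassion2016, §2.3 (Fact 2 and its proof, pp. 6–7)] -/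
theorem DuminilCopinSidoraviciusTassion2016_fact2_of_surgOut (r N₀ : ℕ)
    (h1 : ∀ k : ℕ, 0 < k → ∀ G : GlueGeom, G.InRange → ∀ ω : BondConfig (slab 3 k),
      ω ⊆ (slabGraph 3 k).edgeSet → ω ∈ G.evX k →
        ∃ Good : Finset (ℤ × ℤ), (↑Good : Set (ℤ × ℤ)) ⊆ G.U k ω ∧ (G.U k ω).ncard ≤ Good.card + N₀ ∧
          ∀ z ∈ Good, ∃ ω' : BondConfig (slab 3 k), G.SurgOut k r ω z ω')
    (h2 : ∀ k : ℕ, 0 < k → ∀ G : GlueGeom, G.InRange → ∀ ω : BondConfig (slab 3 k),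
      ω ⊆ (slabGraph 3 k).edgeSet → ω ∈ G.evX k → (G.U k ω).Nonempty →
        ∃ (z : ℤ × ℤ) (ω' : BondConfig (slab 3 k)), G.SurgOut k r ω z ω') :
    DuminilCopinSidoraviciusTassion2016_fact2 := by
  intro k hk p hp0 hp1
  -- the rate form `∃ K, ∀ t ≥ 1, P[𝒳 ∩ {|U| ≥ t}] ≤ (K/t) P[C]` implies the printed statement
  refine DuminilCopinSidoraviciusTassion2016_fact2_bound_of_rate 1 ?_
  set lam : ℝ := 2 / min (p : ℝ) (1 - p) with hlam
  set s : ℕ := (5 * k + 4) * (2 * (r + 3) + 1) ^ 2 with hs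
  have hL0 : 0 ≤ lam ^ s := by
    have : 0 ≤ lam := by
      rw [hlam]
      exact div_nonneg (by norm_num) (le_min hp0.le (by linarith))
    exact pow_nonneg this s
  refine ⟨338 * lam ^ s + (2 * N₀ + 1) * lam ^ s, fun t ht G hG => ?_⟩
  set P := bondPercolation (slabGraph 3 k) p with hP
  have hC0 : 0 ≤ P.real (G.evC k) := measureReal_nonneg
  have ht0 : (0 : ℝ) < t := by exact_mod_cast ht
  by_cases htN : 2 * N₀ ≤ t
  · have hbig := G.real_evX_ncard_le k p hp0 hp1 r N₀ (h1 k hk G hG) ht htN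
    rw [← hlam, ← hs] at hbig
    refine hbig.trans (mul_le_mul_of_nonneg_right ?_ hC0)
    rw [div_le_div_iff_of_pos_right ht0]
    nlinarith
  · have hsmall := G.real_evX_nonempty_le k p hp0 hp1 r (h2 k hk G hG)
    rw [← hlam, ← hs] at hsmall
    have hmono : P.real (G.evX k ∩ {ω | t ≤ (G.U k ω).ncard}) ≤
        P.real (G.evX k ∩ {ω | (G.U k ω).Nonempty}) := by
      refine measureReal_mono ?_
      rintro ω ⟨hX, htU⟩
      refine ⟨hX, Set.nonempty_of_ncard_ne_zero ?_⟩
      have : t ≤ (G.U k ω).ncard := htU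
      omega
    have htle : (t : ℝ) ≤ 2 * N₀ + 1 := by
      have : t ≤ 2 * N₀ + 1 := by omega
      exact_mod_cast this
    have hkey : lam ^ s ≤ (338 * lam ^ s + (2 * N₀ + 1) * lam ^ s) / t := by
      rw [le_div_iff₀ ht0]
      nlinarith
    calc P.real (G.evX k ∩ {ω | t ≤ (G.U k ω).ncard})
        ≤ P.real (G.evX k ∩ {ω | (G.U k ω).Nonempty}) := hmono
      _ ≤ lam ^ s * P.real (G.evC k) := hsmall
      _ ≤ (338 * lam ^ s + (2 * N₀ + 1) * lam ^ s) / t * P.real (G.evC k) :=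
          mul_le_mul_of_nonneg_right hkey hC0

end Reduction

end Literature.Probability.Percolation

end
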